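/-
Copyright (c) 2026 the pub-hodgecm-mathlib formalisation cell (harness21).  Prover seat hodgecm-mathlib-LH4-p09 (g9), req620 Track A «(D-RAM) FOUR-FRAME» squad
(STAGE-1b, row (2) of the piece `f_{T₊}`, the (β₂) road; dealer∕pen LH4-plan (g13) WORDs #102∕#112∕#116: (β₂-H) face owner; mechanism of record F0P3-p01 (g36)
TORUS-FLIP ∕ OMEGA-CHECK 14:25Z–14:28Z), 2026-09-04.
-/
import Summits.HodgeConjecture.HodgeConjecture.Theorems.F0P3cDyRamGlueLabelPlaneDominated   -- ★ (LH4-p13 (g8)) (S-2) part i: `latticeValueSetMod_glued_eq_of_line_small`; brings ★ p860233 `BlockGlueValueSet`, ★ census DEFS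
import HarnessLib

/-!
# Crux `H413`, line LH4 «(D-RAM) FOUR-FRAME» — STAGE-1b, row (2), the (β₂) road: «PLANE SCALING» — a similitude of the plane commuting with `γ₂` multiplies the plane value set
# of `Γ − 1` on a glued vertex by its multiplier; hence (plane-dominated cells) the census letter `latticeValueSetMod` of the vertex over `ε·Λ` is `ξ •` that of the vertex over `Λ`

Cell `hodgecm-mathlib` (D-0151), FLOOR 0, crux item H413 = `stmt-HodgeConjecture-24833`, route of record `HCCMUnconditional`; squad F0∕P3c∕LH4; lane
`--supports stmt-HodgeConjecture-24833 --as helper` (count-neutral; pays NO tier-0 row).  THEOREMS ONLY (no `def`, no instance, no notation, no `sorry`, default heartbeats).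
DATUM-FREE lattice algebra in the plane letters of ★ p860233 `F0P3cDyRamBlockGlueValueSet` ∕ ★ `F0P3cDyRamGlueLabelPlaneDominated` (`K` with `Valued K ℤᵐ⁰`, `σ : K →+* K`
isometric, block form `H = !![H₂ 0 0, 0, h, 0; …]`, block element `Γ = ι(γ₂, u)`; no self-duality, no `|2|`, no residue field).

WHY (the mechanism of record for (β₂-H), F0P3-p01 (g36) TORUS-FLIP 03c675ee ∕ OMEGA-CHECK 0de4640b on the GLUEFIBRE keys: on every pure cone cell the plane torus acts on the
fibres `Λ₀ ↦ ε·Λ₀` and `label(ε·Λ₀) = ψ_cell(ε)·label(Λ₀)` for a CHARACTER `ψ_cell` of the cell stabiliser; on the «ω-cells» `ψ_cell(ε) = ω_{E∕F}(N_Θ ε)`).  The theory behind the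
ω-cells is this file: a plane similitude `ε` with multiplier `ξ` (`⟨εx, εy⟩_{H₂} = ξ⟨x, y⟩_{H₂}`) commuting with `γ₂` sends the glue data `(B₂, w₀)` to `(ε·B₂, ε·w₀)` and MULTIPLIES
EVERY PLANE VALUE `⟨β′, (γ₂ − u)β′⟩ + (u − 1)⟨β′, β′⟩` BY `ξ`; the `ϖ^m`-thickening is respected since `|ξ| = 1`.  With LH4-p13 (g8)'s ★ `latticeValueSetMod_glued_eq_of_line_small`
(on a plane-dominated vertex the census value set IS the plane value set) the census letter of the vertex over `ε·Λ` is `ξ •` that of the vertex over `Λ` — so its class, hence the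
label, moves by the class of `ξ`: `ψ(ε) = ω(ξ)` (the clean dichotomy ★ p860337 turns «value set scaled by a non-norm» into «label reversed»; that composition is the consumer's).
The same lemma serves (S-2) part ii (the two literal plane models `(antidiag, g_w)` ∕ `(diag dg, γ₁)` differ by a similitude on dictionary-matched `Λ`).
* §1 `planePairing_mulVec_eq` — `⟨ε v, (γ₂ − c)(ε v)⟩ + (c − 1)⟨εv, εv⟩ = ξ·(⟨v, (γ₂ − c)v⟩ + (c − 1)⟨v, v⟩)` for a `γ₂`-commuting similitude;
  `planeValueSet_map_eq_image_mul` — the thickened plane value set over `(ε·B₂, ε·w₀)` is the image under `z ↦ ξ·z` of the one over `(B₂, w₀)` (`|ξ| = 1`).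
* §2 `latticeValueSetMod_glued_eq_planeSet_of_line_small` (single-lattice form of ★ `…PlaneDominated` §3); `latticeValueSetMod_glued_map_eq_image_mul` — for two plane-dominated glued vertices `M` (over `(B₂, w₀, x₀)`) and `M′` (over `(ε·B₂, ε·w₀, x₀′)`, same tube `b`), both line terms
  `ϖ^m`-small (★ `…_of_line_small`'s `hline`): `latticeValueSetMod σ ϖ m M′ (Γ − 1) = (ξ·) '' latticeValueSetMod σ ϖ m M (Γ − 1)`.
HONEST LABEL.  Count-neutral lattice algebra; nothing printed is asserted; no census law is stated; (β₂) stays a HYPOTHESIS and the (β₂-H) face beyond the ω-cells stays OPEN;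
`HC_CM` is proved only modulo the 7 printed citations (2 remaining named inputs: hLiu418 = `stmt-HodgeConjecture-24832`, h413 = `stmt-HodgeConjecture-24833`) until rung 0 closes.
## References
* [Jacobowitz1962] R. Jacobowitz, *Hermitian forms over local fields*, Amer. J. Math. 84 (1962): §4 (dual lattices, modular components, similitudes of hermitian planes).
* [Rogawski1990] J. D. Rogawski, *Automorphic Representations of Unitary Groups in Three Variables*, Ann. of Math. Stud. 123 (1990): §4.9 Prop. 4.9.1 (b) p. 55 (the labelled census of `f_{T₊}`).
* [Kottwitz1986BaseChangeUnits] R. E. Kottwitz, *Base change for unit elements of Hecke algebras*, Compositio Math. 60 (1986): §1 pp. 240–241.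
-/

set_option autoImplicit false

noncomputable section
namespace Summit.HodgeConjecture.HodgeConjecture.Cruxes.H413.F0P3cDyRamGlueLabelPlaneScaling

open scoped Valued WithZero Matrix MatrixGroups
open Literature.NumberTheory.Automorphic Literature.NumberTheory.Automorphic.HermitianLattice Literature.NumberTheory.Automorphic.UnitaryLatticeTree
open Literature.NumberTheory.Rogawski1990
open Summit.HodgeConjecture.HodgeConjecture.Cruxes.H413.F0P3cDyRamBlockGlueValueSet
open Summit.HodgeConjecture.HodgeConjecture.Cruxes.H413.F0P3cDyRamGlueLabelPlaneDominated
open Summit.HodgeConjecture.HodgeConjecture.Cruxes.H413.F0P3cDyRamFourFrameCensusDefs (latticeValueSetMod LatticeLabelPlus)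

variable {K : Type*} [Field K] [Valued K ℤᵐ⁰]

/-! ## §1 A `γ₂`-commuting similitude multiplies every plane value by its multiplier -/

omit [Valued K ℤᵐ⁰] in
/-- **THE PLANE VALUE UNDER A `γ₂`-COMMUTING SIMILITUDE**: if `⟨εx, εy⟩_{H₂} = ξ·⟨x, y⟩_{H₂}` for all `x, y` and `ε·γ₂ = γ₂·ε`, then for every `v` and scalar `c`
`⟨εv, (γ₂ − c)(εv)⟩ + (c − 1)·⟨εv, εv⟩ = ξ·(⟨v, (γ₂ − c)v⟩ + (c − 1)·⟨v, v⟩)`. [cite: Jacobowitz1962, §4] -/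
theorem planePairing_mulVec_eq (σ : K →+* K) (H₂ : Matrix (Fin 2) (Fin 2) K) {ε : Matrix (Fin 2) (Fin 2) K} {ξ : K}
    (hε : ∀ x y : Fin 2 → K, pairing σ H₂ (ε *ᵥ x) (ε *ᵥ y) = ξ * pairing σ H₂ x y)
    (γ₂ : Matrix (Fin 2) (Fin 2) K) (hεγ : ε * γ₂ = γ₂ * ε) (c : K) (v : Fin 2 → K) :
    pairing σ H₂ (ε *ᵥ v) ((γ₂ - c • (1 : Matrix (Fin 2) (Fin 2) K)) *ᵥ (ε *ᵥ v)) + (c - 1) * pairing σ H₂ (ε *ᵥ v) (ε *ᵥ v) =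
      ξ * (pairing σ H₂ v ((γ₂ - c • (1 : Matrix (Fin 2) (Fin 2) K)) *ᵥ v) + (c - 1) * pairing σ H₂ v v) := by
  have hcomm : (γ₂ - c • (1 : Matrix (Fin 2) (Fin 2) K)) *ᵥ (ε *ᵥ v) = ε *ᵥ ((γ₂ - c • (1 : Matrix (Fin 2) (Fin 2) K)) *ᵥ v) := by
    rw [Matrix.mulVec_mulVec, Matrix.mulVec_mulVec, sub_mul, mul_sub, Matrix.smul_mul, Matrix.mul_smul, Matrix.one_mul, Matrix.mul_one, hεγ]
  rw [hcomm, hε, hε]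
  ring

/-- **«PLANE SCALING»: THE THICKENED PLANE VALUE SET OVER `(ε·B₂, ε·w₀)` IS `ξ ·` THE ONE OVER `(B₂, w₀)`** (`ε` a similitude with unit multiplier `ξ` commuting with `γ₂`; every
`γ₂`, `u`, `m`).  The plane set is the right-hand side of ★ `valueSet_endoGL_sub_one_glued_eq_plane_of_line_small`. [cite: Jacobowitz1962, §4] [cite: Rogawski1990, §4.9 Prop. 4.9.1 (b) p. 55] -/
theorem planeValueSet_map_eq_image_mul (σ : K →+* K) (H₂ : Matrix (Fin 2) (Fin 2) K) {ε : Matrix (Fin 2) (Fin 2) K} {ξ : K} (hξ1 : Valued.v ξ = 1)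
    (hε : ∀ x y : Fin 2 → K, pairing σ H₂ (ε *ᵥ x) (ε *ᵥ y) = ξ * pairing σ H₂ x y)
    (γ₂ : GL (Fin 2) K) (hεγ : ε * (γ₂ : Matrix (Fin 2) (Fin 2) K) = (γ₂ : Matrix (Fin 2) (Fin 2) K) * ε) (u : GL (Fin 1) K)
    (B₂ : Submodule 𝒪[K] (Fin 2 → K)) (w₀ : Fin 2 → K) (ϖ : K) (m : ℕ) :
    {z : K | ∃ β ∈ B₂.map ((Matrix.toLin' ε).restrictScalars 𝒪[K]), ∃ a : K, Valued.v a ≤ 1 ∧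
        Valued.v ((ϖ ^ m)⁻¹ * (z - (pairing σ H₂ (β + a • (ε *ᵥ w₀)) ((((γ₂ : Matrix (Fin 2) (Fin 2) K) - (u : Matrix (Fin 1) (Fin 1) K) 0 0 • (1 : Matrix (Fin 2) (Fin 2) K))) *ᵥ (β + a • (ε *ᵥ w₀))) +
          ((u : Matrix (Fin 1) (Fin 1) K) 0 0 - 1) * pairing σ H₂ (β + a • (ε *ᵥ w₀)) (β + a • (ε *ᵥ w₀))))) ≤ 1} =
      (fun z => ξ * z) '' {z : K | ∃ β ∈ B₂, ∃ a : K, Valued.v a ≤ 1 ∧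
        Valued.v ((ϖ ^ m)⁻¹ * (z - (pairing σ H₂ (β + a • w₀) ((((γ₂ : Matrix (Fin 2) (Fin 2) K) - (u : Matrix (Fin 1) (Fin 1) K) 0 0 • (1 : Matrix (Fin 2) (Fin 2) K))) *ᵥ (β + a • w₀)) +
          ((u : Matrix (Fin 1) (Fin 1) K) 0 0 - 1) * pairing σ H₂ (β + a • w₀) (β + a • w₀)))) ≤ 1} := by
  have hξ0 : ξ ≠ 0 := fun h0 => by rw [h0, map_zero] at hξ1; exact zero_ne_one hξ1
  -- abbreviate the plane value
  set c : K := (u : Matrix (Fin 1) (Fin 1) K) 0 0 with hc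
  set V : (Fin 2 → K) → K := fun v => pairing σ H₂ v ((((γ₂ : Matrix (Fin 2) (Fin 2) K) - c • (1 : Matrix (Fin 2) (Fin 2) K))) *ᵥ v) + (c - 1) * pairing σ H₂ v v with hV
  have hscale : ∀ v, V (ε *ᵥ v) = ξ * V v := fun v => planePairing_mulVec_eq σ H₂ hε _ hεγ c v
  have hlin : ∀ (β₀ : Fin 2 → K) (a : K), ε *ᵥ β₀ + a • (ε *ᵥ w₀) = ε *ᵥ (β₀ + a • w₀) := fun β₀ a => by
    rw [Matrix.mulVec_add, Matrix.mulVec_smul]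
  have hmem : ∀ β, β ∈ B₂.map ((Matrix.toLin' ε).restrictScalars 𝒪[K]) ↔ ∃ β₀ ∈ B₂, ε *ᵥ β₀ = β := fun β => by
    rw [Submodule.mem_map]
    simp only [LinearMap.coe_restrictScalars, Matrix.toLin'_apply]
  -- the thickening commutes with multiplication by the unit `ξ`
  have hth : ∀ z t : K, Valued.v ((ϖ ^ m)⁻¹ * (z - ξ * t)) = Valued.v ((ϖ ^ m)⁻¹ * (ξ⁻¹ * z - t)) := fun z t => by
    rw [show (ϖ ^ m)⁻¹ * (z - ξ * t) = ξ * ((ϖ ^ m)⁻¹ * (ξ⁻¹ * z - t)) by field_simp, map_mul, hξ1, one_mul]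
  ext z
  simp only [Set.mem_setOf_eq, Set.mem_image]
  constructor
  · rintro ⟨β, hβ, a, ha, hz⟩
    obtain ⟨β₀, hβ₀, rfl⟩ := (hmem β).1 hβ
    refine ⟨ξ⁻¹ * z, ⟨β₀, hβ₀, a, ha, ?_⟩, by rw [mul_inv_cancel_left₀ hξ0]⟩
    have h1 : V (ε *ᵥ β₀ + a • (ε *ᵥ w₀)) = ξ * V (β₀ + a • w₀) := by rw [hlin, hscale]
    have hz' : Valued.v ((ϖ ^ m)⁻¹ * (z - V (ε *ᵥ β₀ + a • (ε *ᵥ w₀)))) ≤ 1 := hz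
    rw [h1, hth] at hz'
    exact hz'
  · rintro ⟨z', ⟨β₀, hβ₀, a, ha, hz'⟩, rfl⟩
    refine ⟨ε *ᵥ β₀, (hmem _).2 ⟨β₀, hβ₀, rfl⟩, a, ha, ?_⟩
    have h1 : V (ε *ᵥ β₀ + a • (ε *ᵥ w₀)) = ξ * V (β₀ + a • w₀) := by rw [hlin, hscale]
    show Valued.v ((ϖ ^ m)⁻¹ * (ξ * z' - V (ε *ᵥ β₀ + a • (ε *ᵥ w₀)))) ≤ 1
    rw [h1, hth, inv_mul_cancel_left₀ hξ0]
    exact hz'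

/-! ## §2 Plane-dominated glued vertices: the census letter moves by the multiplier -/

/-- **THE CENSUS LETTER OF A PLANE-DOMINATED GLUED VERTEX IS ITS PLANE SET** (single-lattice form of ★ `latticeValueSetMod_glued_eq_of_line_small` ∕
★ `valueSet_endoGL_sub_one_glued_eq_plane_of_line_small` at `Φ₃ = block(Φ₂, 1)`): in ★ p860233's glue letters, if the line term is `ϖ^m`-small then
`latticeValueSetMod σ ϖ m M (Γ − 1) = {z ∣ ∃ β ∈ B₂, ∃ a, |a| ≤ 1 ∧ |(ϖ^m)⁻¹(z − (⟨β′, (γ₂ − u₀₀)β′⟩ + (u₀₀ − 1)⟨β′, β′⟩))| ≤ 1}`, `β′ = β + a·w₀`.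
[cite: Jacobowitz1962, §4] [cite: Rogawski1990, §4.9 Prop. 4.9.1 (b) p. 55] -/
theorem latticeValueSetMod_glued_eq_planeSet_of_line_small (σ : K →+* K) (hvσ : ∀ x, Valued.v (σ x) = Valued.v x) {ϖ : K} (hϖ : Valued.v ϖ = WithZero.exp (-1 : ℤ))
    {M : Submodule 𝒪[K] (Fin 3 → K)} {b : ℕ} (hpr : ∀ x ∈ M, Valued.v (x 1) * Valued.v ϖ ^ b ≤ 1)
    {B₂ : Submodule 𝒪[K] (Fin 2 → K)} {w₀ : Fin 2 → K} {x₀ : Fin 3 → K}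
    (hB : B₂.map ((Matrix.toLin' (!![1, 0; 0, 0; 0, 1] : Matrix (Fin 3) (Fin 2) K)).restrictScalars 𝒪[K]) =
      M ⊓ LinearMap.ker ((LinearMap.proj (1 : Fin 3) : (Fin 3 → K) →ₗ[K] K).restrictScalars 𝒪[K]))
    (hx₀ : x₀ ∈ M) (hx₀1 : Valued.v (x₀ 1) * Valued.v ϖ ^ b = 1) (hprx : x₀ - Pi.single 1 (x₀ 1) = ![w₀ 0, 0, w₀ 1])
    (γ₂ : GL (Fin 2) K) (u : GL (Fin 1) K) (m : ℕ)
    (hline : Valued.v ((ϖ ^ m)⁻¹ * (((u : Matrix (Fin 1) (Fin 1) K) 0 0 - 1) * (σ (x₀ 1) * (1 : K) * x₀ 1))) ≤ 1) :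
    latticeValueSetMod σ ϖ m M (((endoGL (γ₂, u) : GL (Fin 3) K) : Matrix (Fin 3) (Fin 3) K) - 1) =
      {z : K | ∃ β ∈ B₂, ∃ a : K, Valued.v a ≤ 1 ∧
        Valued.v ((ϖ ^ m)⁻¹ * (z - (pairing σ ((StdForm.antidiagonal 2).over K) (β + a • w₀) ((((γ₂ : Matrix (Fin 2) (Fin 2) K) - (u : Matrix (Fin 1) (Fin 1) K) 0 0 • (1 : Matrix (Fin 2) (Fin 2) K))) *ᵥ (β + a • w₀)) +
          ((u : Matrix (Fin 1) (Fin 1) K) 0 0 - 1) * pairing σ ((StdForm.antidiagonal 2).over K) (β + a • w₀) (β + a • w₀)))) ≤ 1} := by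
  rw [latticeValueSetMod_endoGL_sub_one_glued_eq_plane σ hϖ hpr hB hx₀ hx₀1 hprx γ₂ u m]
  have key := setOf_thicken_add_small_eq ϖ m B₂
      (fun β a => pairing σ ((StdForm.antidiagonal 2).over K) (β + a • w₀)
          ((((γ₂ : Matrix (Fin 2) (Fin 2) K) - (u : Matrix (Fin 1) (Fin 1) K) 0 0 • (1 : Matrix (Fin 2) (Fin 2) K))) *ᵥ (β + a • w₀)) +
        ((u : Matrix (Fin 1) (Fin 1) K) 0 0 - 1) * pairing σ ((StdForm.antidiagonal 2).over K) (β + a • w₀) (β + a • w₀))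
      (fun _ a => ((u : Matrix (Fin 1) (Fin 1) K) 0 0 - 1) * (σ (a * x₀ 1) * 1 * (a * x₀ 1)))
      (fun β _ a ha => (v_lineTerm_le σ hvσ ϖ m _ 1 (x₀ 1) ha).trans hline)
  have e1 : ∀ (β : Fin 2 → K) (a : K) (z : K),
      (ϖ ^ m)⁻¹ * (z - (pairing σ ((StdForm.antidiagonal 2).over K) (β + a • w₀)
          ((((γ₂ : Matrix (Fin 2) (Fin 2) K) - (u : Matrix (Fin 1) (Fin 1) K) 0 0 • (1 : Matrix (Fin 2) (Fin 2) K))) *ᵥ (β + a • w₀)) +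
        ((u : Matrix (Fin 1) (Fin 1) K) 0 0 - 1) * (pairing σ ((StdForm.antidiagonal 2).over K) (β + a • w₀) (β + a • w₀) + σ (a * x₀ 1) * 1 * (a * x₀ 1)))) =
      (ϖ ^ m)⁻¹ * (z - ((pairing σ ((StdForm.antidiagonal 2).over K) (β + a • w₀)
          ((((γ₂ : Matrix (Fin 2) (Fin 2) K) - (u : Matrix (Fin 1) (Fin 1) K) 0 0 • (1 : Matrix (Fin 2) (Fin 2) K))) *ᵥ (β + a • w₀)) +
        ((u : Matrix (Fin 1) (Fin 1) K) 0 0 - 1) * pairing σ ((StdForm.antidiagonal 2).over K) (β + a • w₀) (β + a • w₀)) +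
        ((u : Matrix (Fin 1) (Fin 1) K) 0 0 - 1) * (σ (a * x₀ 1) * 1 * (a * x₀ 1)))) := fun β a z => by ring
  simp only [e1]
  exact key

/-- **«PLANE SCALING» FOR THE CENSUS LETTER: THE VERTEX OVER `ε·Λ` HAS `ξ ·` THE VALUE SET OF THE VERTEX OVER `Λ`** (plane-dominated cells).  Two glued lattices `M` (over
`(B₂, w₀)`, generator `x₀`) and `M′` (over `(ε·B₂, ε·w₀)`, generator `x₀′`), same tube `b`, both with `ϖ^m`-small line term, `ε` a `γ₂`-commuting similitude of `(E², Φ₂)` with unit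
multiplier `ξ`: `latticeValueSetMod σ ϖ m M′ (Γ − 1) = (ξ·) '' latticeValueSetMod σ ϖ m M (Γ − 1)` — so the class of the value set, hence the transvection label, moves by the
class of `ξ` (the ω-cells of F0P3-p01's OMEGA-CHECK: `ψ(ε) = ω(ξ)`). [cite: Rogawski1990, §4.9 Prop. 4.9.1 (b) p. 55] [cite: Jacobowitz1962, §4] -/
theorem latticeValueSetMod_glued_map_eq_image_mul (σ : K →+* K) (hvσ : ∀ x, Valued.v (σ x) = Valued.v x) {ϖ : K} (hϖ : Valued.v ϖ = WithZero.exp (-1 : ℤ))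
    {M M' : Submodule 𝒪[K] (Fin 3 → K)} {b : ℕ} (hpr : ∀ x ∈ M, Valued.v (x 1) * Valued.v ϖ ^ b ≤ 1) (hpr' : ∀ x ∈ M', Valued.v (x 1) * Valued.v ϖ ^ b ≤ 1)
    {B₂ : Submodule 𝒪[K] (Fin 2 → K)} {w₀ : Fin 2 → K} {x₀ x₀' : Fin 3 → K} {ε : Matrix (Fin 2) (Fin 2) K} {ξ : K} (hξ1 : Valued.v ξ = 1)
    (hε : ∀ x y : Fin 2 → K, pairing σ ((StdForm.antidiagonal 2).over K) (ε *ᵥ x) (ε *ᵥ y) = ξ * pairing σ ((StdForm.antidiagonal 2).over K) x y)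
    (γ₂ : GL (Fin 2) K) (hεγ : ε * (γ₂ : Matrix (Fin 2) (Fin 2) K) = (γ₂ : Matrix (Fin 2) (Fin 2) K) * ε) (u : GL (Fin 1) K) (m : ℕ)
    (hB : B₂.map ((Matrix.toLin' (!![1, 0; 0, 0; 0, 1] : Matrix (Fin 3) (Fin 2) K)).restrictScalars 𝒪[K]) =
      M ⊓ LinearMap.ker ((LinearMap.proj (1 : Fin 3) : (Fin 3 → K) →ₗ[K] K).restrictScalars 𝒪[K]))
    (hB' : (B₂.map ((Matrix.toLin' ε).restrictScalars 𝒪[K])).map ((Matrix.toLin' (!![1, 0; 0, 0; 0, 1] : Matrix (Fin 3) (Fin 2) K)).restrictScalars 𝒪[K]) =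
      M' ⊓ LinearMap.ker ((LinearMap.proj (1 : Fin 3) : (Fin 3 → K) →ₗ[K] K).restrictScalars 𝒪[K]))
    (hx₀ : x₀ ∈ M) (hx₀' : x₀' ∈ M') (hx₀1 : Valued.v (x₀ 1) * Valued.v ϖ ^ b = 1) (hx₀'1 : Valued.v (x₀' 1) * Valued.v ϖ ^ b = 1)
    (hprx : x₀ - Pi.single 1 (x₀ 1) = ![w₀ 0, 0, w₀ 1]) (hprx' : x₀' - Pi.single 1 (x₀' 1) = ![(ε *ᵥ w₀) 0, 0, (ε *ᵥ w₀) 1])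
    (hline : Valued.v ((ϖ ^ m)⁻¹ * (((u : Matrix (Fin 1) (Fin 1) K) 0 0 - 1) * (σ (x₀ 1) * (1 : K) * x₀ 1))) ≤ 1)
    (hline' : Valued.v ((ϖ ^ m)⁻¹ * (((u : Matrix (Fin 1) (Fin 1) K) 0 0 - 1) * (σ (x₀' 1) * (1 : K) * x₀' 1))) ≤ 1) :
    latticeValueSetMod σ ϖ m M' (((endoGL (γ₂, u) : GL (Fin 3) K) : Matrix (Fin 3) (Fin 3) K) - 1) =
      (fun z => ξ * z) '' latticeValueSetMod σ ϖ m M (((endoGL (γ₂, u) : GL (Fin 3) K) : Matrix (Fin 3) (Fin 3) K) - 1) := by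
  rw [latticeValueSetMod_glued_eq_planeSet_of_line_small σ hvσ hϖ hpr' hB' hx₀' hx₀'1 hprx' γ₂ u m hline',
    latticeValueSetMod_glued_eq_planeSet_of_line_small σ hvσ hϖ hpr hB hx₀ hx₀1 hprx γ₂ u m hline]
  exact planeValueSet_map_eq_image_mul σ _ hξ1 hε γ₂ hεγ u B₂ w₀ ϖ m

end Summit.HodgeConjecture.HodgeConjecture.Cruxes.H413.F0P3cDyRamGlueLabelPlaneScaling

end
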